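import Summits.BirchSwinnertonDyer.BirchSwinnertonDyer.Theses.ResidualThetaTransportAtTwo
import Summits.BirchSwinnertonDyer.BirchSwinnertonDyer.Theorems.ResidualThetaTransportAtTwoResidualThetaCountAtTwoOfCountLower
import HarnessLib

/-!
# Skeleton «closes_binders» for the crux R= `ResidualThetaCountAtTwo` (stmt-BirchSwinnertonDyer-24195, RTT r202)

Line-writer skeleton (linewriter-bsd-display13-1 g0, 2026-08-31; pen bsd-wall-p2 g24 pointer, INBOX l.1564). BY-NAME COMPOSITION over
the route's `closes` binders — NOT leaf progress. BSD is not proved by this.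

THE LINE. R= (the EXACT residual theta count at 2: on the habitat⁺ — W non-CM, r_an = 0, good supersingular at 2 with a₂ = 0,
Δ_W < 0 — for every CM theta partner (g, ι, Ω) congruent to W outside 2M·N_W and every admissible odd S₀, `#R⁺_{S₀}(W[2]) =
2^(d + Σ_g)`) is TWO inequalities. `≥` is the route's live crux (R≥)ᵖ `ResidualThetaCountLowerPureAtTwo` (26074; LEAD rtt-p2
line `Cruxes/ResidualThetaCountLowerPureAtTwo/Lines/bt26_lambda.lean`, registry 9599844fb8e01051 — CITED here by name, not
re-keyed). `≤` is a THEOREM modulo the route's print binders and its cruxes K3P′ (25631) and Kan⁺ (20688):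
`ResidualThetaLayer.residualThetaCountAtTwo_of_residualLowerPure_of_pub` (Theorems/…ResidualThetaCountAtTwoOfCountLower.lean; converse
`residualThetaCountLowerAtTwo_of_count` in the same file), so **24195 ⟺ 26074 modulo K3P′ · Kan⁺ · print, both directions landed**.
This skeleton states the seven binders of that theorem as stubs BY NAME (each is a route item = registered obligation) and proves
`ResidualThetaCountAtTwo_of` in the kernel. Research content lives on the named items' own lines; nothing here is a new lemma.

STUBS (r = research item by name, p = print/PUB binder by name):
* r `stub_residualThetaCountLowerPure` = 26074 (R≥)ᵖ — LEAD-held; line bt26_lambda v10 (open stubs there: PUB-G, GZK, PUB-CM datum,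
  RSL_g print inputs, KZ_g children A/B). Strategy: NOT re-cut here (single-slot registry; HANDS OFF per pen).
* r `stub_signedKatoDivisibilityUpToOfPub` = 25631 K3P′ — Kato's divisibility `char X⁺ ∣ 2^m·L⁺` at 2 FROM its published inputs;
  research content = the K3 lead's R2c `stub_layerSideTwoInv` (line colemanrat v7 4099f1720feba091: T₂E-adic layer-n local Tate
  pairing with (P1)–(P3) + Poitou–Tate along ℚ_∞ + explicit reciprocity at 2), kernel certificate
  `SignedKatoOffTwo.signedKatoDivisibilityUpToAtTwo_of_contraFact_of_gzk_of_layerSide` landed (p603443).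
* r `stub_thetaLayerLambdaCongruence` = 20688 Kan⁺ — analytic theta transport of layer λ-invariants; SPLIT gen 1 into
  `PublishedInputsHeckeAtTwo` (27435, print) + `CuspSpanEvenAtTwoOdd` (node; a theorem at every odd level per
  `Rows.cuspSpanEvenAtTwo_of_not_two_dvd`) + glue `ThetaLayerLambdaCongruenceAtTwoGlue`; HELD.
* p `stub_modularParametrizationSupply` = 19266 [print: BCDT 2001 Thm A (modularity) — `nonempty_modularParametrizationData`].
* p `stub_publishedInputsGreenbergControl` = 24143 PUB-G [print: Greenberg LNM 1716 Prop 4.12/4.13, pp. 108, 119–120, 140].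
* p `stub_rankEqAnalyticRankLeOne` = 19921 GZK [print: Gross–Zagier 1986 + Kolyvagin 1990: r_an ≤ 1 ⇒ rank = r_an].
* p `stub_katoEulerSystemBoundContraSupply` = 25632 KES [print: Kato 2004 Astérisque 295 Thm 13.4(2) at p = 2, contragredient form].
-/

set_option autoImplicit false
set_option linter.dupNamespace false

noncomputable section

namespace Summit.BirchSwinnertonDyer.BirchSwinnertonDyer.Cruxes.ResidualThetaCountAtTwo.ClosesBinders

open Summit.BirchSwinnertonDyer.BirchSwinnertonDyer.Theses.ResidualThetaTransportAtTwo

/-- r-stub (by name = crux 26074 (R≥)ᵖ, LEAD line bt26_lambda 9599844fb8e01051): the LOWER residual theta count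
`2^(d + Σ_g) ≤ #R⁺_{S₀}(W[2])`. [cite: GreenbergVatsal2000, Prop. 2.8 and (10)] [cite: PollackRubin2004] -/
theorem stub_residualThetaCountLowerPure : ResidualThetaCountLowerPureAtTwo := by
  sorry

/-- r-stub (by name = K3P′ 25631): signed Kato divisibility up to `2^m` at 2 from its published inputs; research = R2c of the
K3 line colemanrat v7. [cite: Kato2004Asterisque, Thm. 12.5, Thm. 13.4 (2), Thm. 17.4] [cite: Kobayashi2003, Thm. 1.2] -/
theorem stub_signedKatoDivisibilityUpToOfPub : SignedKatoDivisibilityUpToAtTwoOfPub := by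
  sorry

/-- r-stub (by name = Kan⁺ 20688, split gen 1): equal layer λ-invariants of the S₀-depleted Mazur–Tate elements of W and of its
CM theta partner g for all large even n. [cite: CorpuzLei2025, Prop. 4.2] [cite: EmertonPollackWeston2006] -/
theorem stub_thetaLayerLambdaCongruence : ThetaLayerLambdaCongruenceAtTwo := by
  sorry

/-- p-stub (by name = 19266) [print: BCDT 2001, Thm. A — modularity / `nonempty_modularParametrizationData`]. -/
theorem stub_modularParametrizationSupply : ModularParametrizationSupply := by
  sorry

/-- p-stub (by name = PUB-G 24143) [print: Greenberg 1999 (LNM 1716), Prop. 4.12, Prop. 4.13, pp. 108, 119–120, 140]. -/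
theorem stub_publishedInputsGreenbergControl : PublishedInputsGreenbergControlAtTwo := by
  sorry

/-- p-stub (by name = GZK 19921) [print: GrossZagier1986 Thm. I.6.3 + Kolyvagin1990: `r_an ≤ 1 ⇒ rank E(ℚ) = r_an`]. -/
theorem stub_rankEqAnalyticRankLeOne : RankEqAnalyticRankLeOne := by
  sorry

/-- p-stub (by name = KES 25632) [print: Kato 2004 (Astérisque 295), Thm. 13.4 (2) at p = 2, print-exact contragredient form]. -/
theorem stub_katoEulerSystemBoundContraSupply : KatoEulerSystemBoundContraAtTwoSupply := by
  sorry

/-- **Composition (kernel; the seven binders BY NAME): R= `ResidualThetaCountAtTwo`** — the pen-pointed closer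
`ResidualThetaLayer.residualThetaCountAtTwo_of_residualLowerPure_of_pub` (K3 from K3P′ with KES and GZK exactly as `closes` does). -/
theorem ResidualThetaCountAtTwo_of : ResidualThetaCountAtTwo :=
  Summit.BirchSwinnertonDyer.BirchSwinnertonDyer.Theorems.ResidualThetaLayer.residualThetaCountAtTwo_of_residualLowerPure_of_pub
    stub_modularParametrizationSupply stub_publishedInputsGreenbergControl stub_rankEqAnalyticRankLeOne
    stub_residualThetaCountLowerPure stub_katoEulerSystemBoundContraSupply stub_signedKatoDivisibilityUpToOfPub
    stub_thetaLayerLambdaCongruence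

end Summit.BirchSwinnertonDyer.BirchSwinnertonDyer.Cruxes.ResidualThetaCountAtTwo.ClosesBinders

end
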